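import Literature.MathematicalPhysics.QuantumFieldTheory.Balaban1983to89.B9Eq365TowerXOperatorLadder
import Literature.MathematicalPhysics.QuantumFieldTheory.Balaban1983to89.B9Eq319QprimeTowerHomMajorants

/-!
# `Balaban1983to89.B9Eq365TowerQGGQWordLadder` — T. Bałaban, *Propagators for lattice gauge theories in a background field*, Commun. Math. Phys. **99** (1985) 389–434
# [Balaban1985BackgroundPropagators] (3.65)–(3.66) p. 403, (3.21) p. 394 («Q′(U)G′²(U)Q′*(U)»), Thm 3.1 (3.42) p. 397, with [Balaban1984PropagatorsII] (2.51)–(2.52) p. 232: **THE JUNCTION OF THE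
# `Q′G′²Q′*`-LADDER WITH THE NE9 CHAIN's THIRD-OPERATOR WORD** — the chain's coarse operator `X_k(U) = Q̃′_k(U) ∘ G′_k(U)² ∘ Q̃′_k(U)†` on `SiteL2K ℂ d m c₁ W` (the operator inverted by
# leaf-03's `B9Eq349ConjugatedQGGQInvSupRowTower`, `B9Eq325ProjFormulaTower`), READ IN `𝔸` by `B9Eq319QprimeTowerHomMajorants.readAHom` and realified by r06's `conjHom b`, IS the word `W(U)` of
# `B9Eq365TowerXOperatorLadder` (`readAHom_comp`, `readAHom_eq_readA`, the identifications `readAHom φ Q̃′_k = kerOp blkK k_Q`, `readAHom φ Q̃′_k† = liftOp blkK s_Q`, `conjHom_comp`,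
# `conjHom_eq_conj`); hence **`conjHom b (readAHom φ X_k(U)) − conjHom b (readAHom φ X_k(1)) ≺ K_X·α·e^{−δ_X d}`** over `towerGeom` on the coarse carrier with fibre, constants BEFORE `n, η, m, U`

statement-level skeleton of published theorems with citation tags; proofs where landed; nothing here is a claim about the Yang–Mills mass gap

CITATION HEADER (lean-in-tree rule).  Audit cell `pub-balaban`, sub-cell `t4`, BINDER row NE9; NE9 crux-team LEAF PROVER 01 (`b2b-balaban-t4-ne9-formalise-leaf-01`,
gen 99; bears_on: R4/N22).  Vocabulary BY NAME: this lineage's `B9Eq319QprimeTowerHomMajorants` (`readAHom`, `readAHom_apply`, `readAHom_Qtilde_eq_kerOp`, `readAHom_adjoint_Qtilde_eq_liftOp`),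
`B9Eq365TowerXOperatorLadder.exists_hasMajorantHom_X_sub_flat`, `B9Eq324PenaltyKernelForm.readA` ∕ `readA_apply`, r06's `B9Eq376POneLetters.conjHom` ∕ `conjHom_comp` ∕ `conjHom_eq_conj`, pv08's
`B6RandomWalkHom.HasMajorantHom`, the chain's `B9Eq326OperatorTower.QprimeTowerW`, `B9Eq324DeltaPrimeATower.GpOfUk`.  Sources read through those files' verbatim quotations:
[Balaban1985BackgroundPropagators] pp. 394, 397, 403; [Balaban1984PropagatorsII] p. 232.  [folklore] functoriality of the readings; COMPOSITION BY NAME; NOTHING of print's proofs is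
reproduced beyond what the named files prove.

WHAT IS PROVED (sorry-free; proof lane — no `def`).
* §1 **`readAHom_comp`**, **`readAHom_eq_readA`** — functoriality of the reading in `𝔸`; **`conjHom_readAHom_QGGQ_eq_word`** — the chain's `X_k(U)` read and realified IS the word `W(U)`.
* §2 **`exists_hasMajorantHom_QGGQ_sub_flat`** — the two-background ladder for the chain's `X_k(U) = Q̃′_k(U)G′_k(U)²Q̃′_k(U)†`: `∃ α_X > 0, K_X ≥ 0, δ_X > 0` BEFORE the lattice, on print's
  small-field class (plus fibre-isometric level transporters), ANY positivity witnesses, ANY `M, R_r, H`.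
HONEST SCOPE.  Junction only (no estimate beyond the imported ladder); constants crude (NOT print's); the Thm-3.1 inputs behind the ladder are the cell's MODEL rows («NE9 ⇐ the named
binders»; O-NE9-1, #5 UNRULED); NOT the inverse `c_k = X_k⁻¹` (the resolvent step with leaf-03's rows and their displayed letters `κ₁, γ, C_Q` is the NEXT brick), NOT `R_k`, NOT the bond
`G_k`; NE9 NOT PRINTED ∕ NOT PROVED; spine PROVED 0∕9; rung (B)+1 finite T⁴ — NOT infinite volume, NOT mass gap, NOT BetaPertH, NOT Clay.  HONEST DEPENDENCY: continuum YM on T⁴ ⇐ BetaPertH ∧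
nine spine estimates (0/9 proved); BetaPertH ⇐ (D1) ∧ (D4) ∧ CAP+tail; G-an2-4 gates asym, D1 and NE2/3/4.  NEW file; nothing modified.  Net new unproved facts: 0.
-/

noncomputable section

open scoped BigOperators InnerProductSpace

namespace Literature.MathematicalPhysics.QuantumFieldTheory.Balaban1983to89.B9Eq365TowerQGGQWordLadder

open B4Sect5Torus (TSite)
open B7Prop1Explicit (U1)
open B9SectCLatticeCarrier (Bond shift)
open B9Eq311L2Pairing (WL2)
open B11Eq103H1Complex (SiteL2K)
open B9Eq310HessianOperator (adTransportW)
open B9Eq315QTower (towerP UlevOf)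
open B9Eq326OperatorTower (QprimeTowerW)
open B9Eq33CovDerivVector (adTransport)
open B9Eq324DeltaPrimeATower (laplacePrimeAk GpOfUk)
open B6RandomWalkHom (HasMajorantHom)
open B9Thm34Ext (toB6)
open B9Eq352DivFormLetters (conj)
open B9Eq376POneLetters (conjHom conjHom_comp conjHom_eq_conj)
open B9Eq360Vprime (kerOp liftOp)
open B9Eq357QprimeTowerKernelForm (blkK kQ)
open B9Eq324PenaltyKernelForm (sQ readA readA_apply)
open B9Eq341TowerBlockGeometry (towerGeom)
open B9Eq319QprimeTowerHomMajorants (readAHom readAHom_apply readAHom_Qtilde_eq_kerOp readAHom_adjoint_Qtilde_eq_liftOp)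
open B9Eq365TowerXOperatorLadder (exists_hasMajorantHom_X_sub_flat)

/-! ## §1 Functoriality of the reading and the identification of the word -/

section Reading

variable {d : ℕ} {P P' P'' : Fin d → ℕ} {𝔸 : Type*} [NormedRing 𝔸] [NormedAlgebra ℂ 𝔸] {W : Type*} [NormedAddCommGroup W] [InnerProductSpace ℂ W]
  (φ : W ≃ₗ[ℂ] 𝔸) {c₀ c₀' c₀'' : ℝ}

/-- `readAHom` is functorial: `readAHom (T₁ ∘ T₂) = readAHom T₁ ∘ readAHom T₂`. [folklore] [cite: Balaban1985BackgroundPropagators, (3.11) p.392; Balaban1984PropagatorsII, (2.52) p.232] -/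
theorem readAHom_comp (T₁ : SiteL2K ℂ d P' c₀' W →ₗ[ℂ] SiteL2K ℂ d P'' c₀'' W) (T₂ : SiteL2K ℂ d P c₀ W →ₗ[ℂ] SiteL2K ℂ d P' c₀' W) :
    readAHom φ (T₁ ∘ₗ T₂) = readAHom φ T₁ ∘ₗ readAHom φ T₂ := by
  apply LinearMap.ext
  intro f
  funext y
  simp only [LinearMap.comp_apply, readAHom_apply, LinearEquiv.symm_apply_apply, Equiv.symm_apply_apply]

/-- On endomorphisms `readAHom` is this lineage's `readA`. [folklore] [cite: Balaban1985BackgroundPropagators, (3.11) p.392] -/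
theorem readAHom_eq_readA (T : SiteL2K ℂ d P c₀ W →ₗ[ℂ] SiteL2K ℂ d P c₀ W) : readAHom φ T = readA φ T := by
  apply LinearMap.ext
  intro f
  funext y
  rw [readAHom_apply, readA_apply]

end Reading

section Word

variable {d : ℕ} (L : ℕ) [NeZero L] (m : Fin d → ℕ) [∀ i, NeZero (m i)] (n : ℕ)
  {𝔸 : Type*} [NormedRing 𝔸] [NormedAlgebra ℂ 𝔸] [CompleteSpace 𝔸] [NormOneClass 𝔸] [FiniteDimensional ℂ 𝔸]
  {W : Type*} [NormedAddCommGroup W] [InnerProductSpace ℂ W] [FiniteDimensional ℂ W] (φ : W ≃ₗ[ℂ] 𝔸)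
  {c₀ : ℝ} [Fact (0 < c₀)] {c₁ : ℝ} [Fact (0 < c₁)] (η : ℝ) (a' : ℝ)
  {ι : Type} [Fintype ι] (b : Module.Basis ι ℝ 𝔸)

omit [NormOneClass 𝔸] in
/-- **THE CHAIN's `Q̃′_kG′_k²Q̃′_k†`, READ AND REALIFIED, IS THE WORD `W`**: `conjHom b (readAHom φ (Q̃′ ∘ (G′ ∘ G′) ∘ Q̃′†)) = conjHom b (kerOp blkK k_Q) ∘ conj b (readA φ (G′ ∘ G′)) ∘ conjHom b (liftOp blkK s_Q)`
for ANY endomorphism `G′` of the fine carrier (here `G′_k(U)`). [cite: Balaban1985BackgroundPropagators, (3.21) p.394, (3.65) p.403; Balaban1984PropagatorsII, (2.51)–(2.52) p.232] -/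
theorem conjHom_readAHom_QGGQ_eq_word (U : Bond d (towerP L m (n + 1)) → 𝔸ˣ)
    (G : SiteL2K ℂ d (towerP L m (n + 1)) c₀ W →ₗ[ℂ] SiteL2K ℂ d (towerP L m (n + 1)) c₀ W) :
    conjHom b (readAHom φ (((WL2.linearEquiv ℂ ℂ (fun _ : TSite d m => c₁)).symm.toLinearMap ∘ₗ QprimeTowerW L m n φ U (c₀ := c₀)) ∘ₗ (G ∘ₗ G) ∘ₗ
        LinearMap.adjoint ((WL2.linearEquiv ℂ ℂ (fun _ : TSite d m => c₁)).symm.toLinearMap ∘ₗ QprimeTowerW L m n φ U (c₀ := c₀)))) =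
      conjHom b (kerOp (blkK L m n) (kQ L m n (fun j => adTransport (𝕜 := ℂ) (UlevOf L m (n + 1) U j)))) ∘ₗ
        conj b (readA φ (G ∘ₗ G)) ∘ₗ conjHom b (liftOp (blkK L m n) (sQ L m n φ U (c₀ := c₀) (c₁ := c₁))) := by
  rw [readAHom_comp, readAHom_comp, readAHom_Qtilde_eq_kerOp, readAHom_adjoint_Qtilde_eq_liftOp, readAHom_eq_readA, ← conjHom_comp, ← conjHom_comp,
    conjHom_eq_conj]

end Word

/-! ## §2 The ladder for the chain's third-operator word -/

section Main

variable {d : ℕ} (L : ℕ) [NeZero L] {𝔸 : Type*} [NormedRing 𝔸] [NormedAlgebra ℂ 𝔸] [CompleteSpace 𝔸] [NormOneClass 𝔸] [StarRing 𝔸] [FiniteDimensional ℂ 𝔸]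
  {W : Type*} [NormedAddCommGroup W] [InnerProductSpace ℂ W] [FiniteDimensional ℂ W] (φ : W ≃ₗ[ℂ] 𝔸) {a' Mφ Mφ' : ℝ}
  (hMφ : 0 ≤ Mφ) (hMφ' : 0 ≤ Mφ') (hφn : ∀ w, ‖φ w‖ ≤ Mφ * ‖w‖) (hφn' : ∀ X, ‖φ.symm X‖ ≤ Mφ' * ‖X‖) (ha' : 0 < a')
  {r : ℝ} (hr0 : 0 ≤ r) (hr1 : r < 1)
  (τ : 𝔸 →ₗ[ℂ] ℂ) (hτ₂ : ∀ X Y : 𝔸, τ (X * Y) = τ (Y * X)) (hφτ : ∀ X Y : 𝔸, ⟪φ.symm X, φ.symm Y⟫_ℂ = τ (star X * Y))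
  {ι : Type} [Fintype ι] [DecidableEq ι] (b : Module.Basis ι ℝ 𝔸) {M₂ : ℝ} (hM₂ : 0 ≤ M₂) (hrepr : ∀ (v : 𝔸) (i : ι), |b.repr v i| ≤ M₂ * ‖v‖)

include hMφ hMφ' hφn hφn' ha' hr0 hr1 hτ₂ hφτ hM₂ hrepr in
/-- **THE TWO-BACKGROUND LADDER FOR THE CHAIN's `X_k(U) = Q̃′_k(U)G′_k(U)²Q̃′_k(U)†`, LATTICE-UNIFORMLY**: `conjHom b (readAHom φ X_k(U)) − conjHom b (readAHom φ X_k(1)) ≺ K_X·α·e^{−δ_X d}` over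
`towerGeom` on the coarse carrier with fibre (block map `(y, i) ↦ y`), for every background of print's small-field class (plus fibre-isometric level transporters), `α ≤ α_X`, the constants
BEFORE `n, η, m, U`. [cite: Balaban1985BackgroundPropagators, (3.65)–(3.66) p.403, (3.21) p.394, Thm 3.1 (3.42) p.397; Balaban1984PropagatorsII, (2.51)–(2.52) p.232] -/
theorem exists_hasMajorantHom_QGGQ_sub_flat (hd : 1 ≤ d) (hL3 : 3 ≤ L) :
    ∃ αX KX δX : ℝ, 0 < αX ∧ 0 ≤ KX ∧ 0 < δX ∧
      ∀ (n : ℕ) (η : ℝ), η * (L : ℝ) ^ (n + 1) = 1 →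
      ∀ (c₀ c₁ : ℝ) [Fact (0 < c₀)] [Fact (0 < c₁)], c₀ * ((L : ℝ) ^ (n + 1)) ^ d = c₁ →
      ∀ (m : Fin d → ℕ) [∀ i, NeZero (m i)] (U : Bond d (towerP L m (n + 1)) → 𝔸ˣ) (α : ℝ), 0 ≤ α → α ≤ αX →
        (∀ bd, U bd ∈ U1 𝔸) → (∀ bd, ‖(U bd : 𝔸) - 1‖ ≤ α * η) →
        (∀ (x : TSite d (towerP L m (n + 1))) (μ ν : Fin d), ‖(U (shift ν x, μ) : 𝔸) - (U (x, μ) : 𝔸)‖ ≤ α * η ^ 2) →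
      ∀ (εU : ℕ → ℝ), (∀ j, 0 ≤ εU j) → (∀ j, εU j ≤ 1) → (∀ j < n + 1, εU j ≤ α * r ^ j) →
        (∀ (j : ℕ) (bd : Bond d (towerP L m (j + 1))), ‖(UlevOf L m (n + 1) U j bd : 𝔸) - 1‖ ≤ εU j) →
        (∀ (j : ℕ) (bd : Bond d (towerP L m (j + 1))), UlevOf L m (n + 1) U j bd ∈ U1 𝔸) →
        (∀ (j : ℕ) (bd : Bond d (towerP L m (j + 1))) (w : W), ‖adTransportW φ (UlevOf L m (n + 1) U j) bd w‖ ≤ ‖w‖) →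
      ∀ (hposU : ∀ x : SiteL2K ℂ d (towerP L m (n + 1)) c₀ W, x ≠ 0 → 0 < RCLike.re ⟪x, laplacePrimeAk L m n φ η U a' (c₁ := c₁) x⟫_ℂ)
        (hpos₁ : ∀ x : SiteL2K ℂ d (towerP L m (n + 1)) c₀ W, x ≠ 0 →
          0 < RCLike.re ⟪x, laplacePrimeAk L m n φ η (fun _ : Bond d (towerP L m (n + 1)) => (1 : 𝔸ˣ)) a' (c₁ := c₁) x⟫_ℂ)
        (M Rr : ℝ) (H : Prop),
      HasMajorantHom (g := toB6 (towerGeom L m n η M) Rr H) (fun q : TSite d m × ι => q.1) (fun q : TSite d m × ι => q.1)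
        (conjHom b (readAHom φ
            (((WL2.linearEquiv ℂ ℂ (fun _ : TSite d m => c₁)).symm.toLinearMap ∘ₗ QprimeTowerW L m n φ U (c₀ := c₀)) ∘ₗ
              (GpOfUk L m n φ η U a' (c₁ := c₁) hposU ∘ₗ GpOfUk L m n φ η U a' (c₁ := c₁) hposU) ∘ₗ
                LinearMap.adjoint ((WL2.linearEquiv ℂ ℂ (fun _ : TSite d m => c₁)).symm.toLinearMap ∘ₗ QprimeTowerW L m n φ U (c₀ := c₀)))) -
          conjHom b (readAHom φ
            (((WL2.linearEquiv ℂ ℂ (fun _ : TSite d m => c₁)).symm.toLinearMap ∘ₗ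
                QprimeTowerW L m n φ (fun _ : Bond d (towerP L m (n + 1)) => (1 : 𝔸ˣ)) (c₀ := c₀)) ∘ₗ
              (GpOfUk L m n φ η (fun _ : Bond d (towerP L m (n + 1)) => (1 : 𝔸ˣ)) a' (c₁ := c₁) hpos₁ ∘ₗ
                  GpOfUk L m n φ η (fun _ : Bond d (towerP L m (n + 1)) => (1 : 𝔸ˣ)) a' (c₁ := c₁) hpos₁) ∘ₗ
                LinearMap.adjoint ((WL2.linearEquiv ℂ ℂ (fun _ : TSite d m => c₁)).symm.toLinearMap ∘ₗ
                  QprimeTowerW L m n φ (fun _ : Bond d (towerP L m (n + 1)) => (1 : 𝔸ˣ)) (c₀ := c₀)))))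
        (fun a a' => KX * α * Real.exp (-(δX * (towerGeom L m n η M).dist a a'))) := by
  obtain ⟨αX, KX, δX, hαX, hKX, hδX, HX⟩ := exists_hasMajorantHom_X_sub_flat L φ hMφ hMφ' hφn hφn' ha' hr0 hr1 τ hτ₂ hφτ b hM₂ hrepr hd hL3
  refine ⟨αX, KX, δX, hαX, hKX, hδX, ?_⟩
  intro n η hη c₀ c₁ _ _ hc m _ U α hα0 hαle hU1 hUs hUw εU hε0 hε1 hεr hlev hlev1 hRlev hposU hpos₁ M Rr H
  rw [conjHom_readAHom_QGGQ_eq_word, conjHom_readAHom_QGGQ_eq_word]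
  exact HX n η hη c₀ c₁ hc m U α hα0 hαle hU1 hUs hUw εU hε0 hε1 hεr hlev hlev1 hRlev hposU hpos₁ M Rr H

end Main

end Literature.MathematicalPhysics.QuantumFieldTheory.Balaban1983to89.B9Eq365TowerQGGQWordLadder

end
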